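import Summits.KontsevichZagierPeriods.KontsevichZagierPeriods.Theorems.RootDecompQuadraticDescentPair18ReductionP7
import Summits.KontsevichZagierPeriods.KontsevichZagierPeriods.Theorems.RootDecompQuadraticDescentPair18HomotopyP31
import Summits.KontsevichZagierPeriods.KontsevichZagierPeriods.Theorems.RootDecompQuadraticDescentPair18HomotopyAngP20
import Summits.KontsevichZagierPeriods.KontsevichZagierPeriods.Theorems.RootDecompQuadraticDescentPair18HomotopyEulerP2
import Summits.KontsevichZagierPeriods.KontsevichZagierPeriods.Theorems.RootDecompQuadraticDescentPair18HomotopyGridP5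

/-! # `RootDecompQuadraticDescentPair18Decided` — census pair #18 DECIDED in the four-move calculus (decomp-kz, route `RootDecompQuadraticDescent`)

The last open row of the weight-2 box scoreboard of the decomp-kz census (50 two-term coincidences `K-M2-DARK`, HOME/census/data/atoms-v5/):
`A18 = [□², 1/(2−x+y+x²−y²)] ≡ 2·B18 = 2·[□², 1/(2+x+2y+x²+2xy)]` as a KZ-relation — an INSTANCE of crux
stmt-KontsevichZagierPeriods-28994 `DescentTwoQ` / of `KZDimTwo` (4280).  Composition of LANDED theorems only (lens-6 g8–g10, critic rows
g3/g4/g5-19 CLEARED; landed by census-1 g9): `Pair18.pair18_iff_strips` (g8, Pair18ReductionP7) reduces the pair to the strip form, and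
`Pair18Homotopy.pair18_g8strips_of_grid hEuler hGrid hAng4` (g9 file #1, Pair18HomotopyP31) proves the strip form from Euler's ζ(2) relation
`hEuler_holds` (g10 file #3), the angle-grid congruence `hGrid_of_charts hTh7_holds hB17_holds` (g10 file #4 over g9 file #2) and the angle side
`hAng4_holds` (g9 file #2).  The two files define the strips `U1, U2r, SL, K12c, Kh` by identical texts in the namespaces `…Pair18` and `…Pair18Homotopy`;
the bridge is definitional (`rfl`). -/

set_option linter.dupNamespace false

namespace Summit.KontsevichZagierPeriods.RootDecompQuadraticDescent.Pair18Decided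

open Literature.NumberTheory.Transcendental
open Summit.KontsevichZagierPeriods.RootDecompQuadraticDescent

/-- The strip forms of the two files agree definitionally. [bookkeeping] -/
theorem strips_eq :
    (KZ.of Pair18.U1.rep - KZ.of Pair18.U2r.rep + KZ.of Pair18.SL.rep - 2 • KZ.of Pair18.K12c.rep + 2 • KZ.of Pair18.Kh.rep) =
    (KZ.of Pair18Homotopy.U1.rep - KZ.of Pair18Homotopy.U2r.rep + KZ.of Pair18Homotopy.SL.rep
      - 2 • KZ.of Pair18Homotopy.K12c.rep + 2 • KZ.of Pair18Homotopy.Kh.rep) := rfl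

/-- **Census pair #18 DECIDED** [cite: KontsevichZagier2001, §1.2 rules (1)–(3)]: `[A18] − 2•[B18] ∈ KZ.relations`, i.e. the two rational weight-2 box
periods `∫∫_{□²} dx dy/(2−x+y+x²−y²)` and `2∫∫_{□²} dx dy/(2+x+2y+x²+2xy)` (both `= ` the same combination of `π²`, `π·arctan√7`, `arctan²√7`, `log²2`) are
EQUIVALENT under the four moves — no hypothesis left (the ζ(2) bridge, the nine-cell angle-grid congruence and the three angle regions are all theorems). -/
theorem pair18_decided : KZ.of Pair18.A18.rep - 2 • KZ.of Pair18.B18.rep ∈ KZ.relations :=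
  Pair18.pair18_iff_strips.mpr
    (Pair18Homotopy.pair18_g8strips_of_grid Pair18Homotopy.hEuler_holds
      (Pair18Homotopy.hGrid_of_charts Pair18Homotopy.hTh7_holds Pair18Homotopy.hB17_holds) Pair18Homotopy.hAng4_holds)

end Summit.KontsevichZagierPeriods.RootDecompQuadraticDescent.Pair18Decided
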